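import Summits.Ventures.PercRepro.C026GoodDegreeBridge

/-!
# THEOREM L2 is unconditional when a live vertex is pendant (p6, gen 20)

Setting of `C026GoodDegreeBridge`: skeleton `(G; a, b, c)`, red = the configuration `S`, blue = `Sᶜ`.
If the live vertex `a` is **pendant** — at most one edge `e` of the multigraph has `a` as an endpoint —
then every `(D,A)` source is `Good_a`: in such a source the edge `e` is red (otherwise `a` would be
red-isolated, against `c ~ a`), so the blue cluster of `a` is `{a}`, and a red walk from `c` to `b`
avoiding `a` exists because closing `e` cannot disconnect `c` from `b` (the contraction lemma
`conn_update_true_iff`: the other alternatives would join `c` or `b` to the then isolated `a`).  Hence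
`n(D,A) = #Good_a ≤ #B₂ ≤ |B|` (`card_goodA_le`), in particular `n(D,A) ≤ 2|B|`, `(E00)` holds
(`pFun_liveCells_nonneg_of_two_mul`) and THEOREM L2 follows at every band state — with the roles of
`a` and `b` exchangeable.

* `cluster_compl_eq_singleton_of_leaf` — the blue cluster of a pendant vertex whose edge is red is
  `{a}`;
* `walkAvoiding_of_leaf` — the red walk from `c` to `b` avoiding `{a}`;
* `good_of_leaf` — every `(D,A)` source is `Good_a` (no distinctness hypothesis: `a ≠ c` and `a ≠ b`
  follow from the blue separation);
* `card_DA_le_of_leaf` — `n(D,A) ≤ #B₂`;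
* `pFun_liveCells_nonneg_of_leaf` / `pFun_liveCells_nonneg_of_leaf'` — `(E00)` for a pendant `a` /
  pendant `b`;
* `pFun_twoCells_nonneg_of_leaf`, `pFun_threeCells_nonneg_of_leaf` (and the primed `b`-versions) —
  THEOREM L2, bare / live probe.

A vertex with no incident edge at all is covered too (take any `e`; the hypothesis is vacuous), and
loops at `a` are allowed (a loop is then the only edge at `a`, and `(D,A)` is empty).
-/

namespace PercRepro

namespace MultiGraph

open Finset

variable {V E : Type*} {G : MultiGraph V E}

/-- A vertex all of whose incident edges are closed has a singleton cluster. -/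
theorem cluster_eq_singleton_of_no_open_edge {ω : Config E} {v : V}
    (hv : ∀ e, ω e = true → G.fst e ≠ v ∧ G.snd e ≠ v) : G.cluster ω v = {v} := by
  ext u
  simp only [mem_cluster, Set.mem_singleton_iff]
  exact ⟨fun h => eq_of_conn_of_isolated hv h, fun h => h ▸ Conn.refl G ω v⟩

/-- **The blue cluster of a pendant vertex with a red edge is a singleton**: if every edge at `a` is
`e` and `e` is red, then `a` has no blue edge. -/
theorem cluster_compl_eq_singleton_of_leaf {S : Config E} {a : V} {e : E}
    (hleaf : ∀ f, G.fst f = a ∨ G.snd f = a → f = e) (he : S e = true) :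
    G.cluster Sᶜ a = {a} := by
  refine cluster_eq_singleton_of_no_open_edge fun f hf => ?_
  by_contra h
  have hfe : f = e := hleaf f (by
    by_cases h1 : G.fst f = a
    · exact Or.inl h1
    · exact Or.inr (by
        by_contra h2
        exact h ⟨h1, h2⟩))
  subst hfe
  rw [compl_apply_not, he] at hf
  exact absurd hf (by decide)

/-- A connection from `c` to `b` in a configuration in which `a` is isolated is a walk avoiding `{a}`
(every step ends at an endpoint of an open edge, which is not `a`). -/
theorem walkAvoiding_singleton_of_isolated {ω : Config E} {a b c : V}
    (hiso : ∀ f, ω f = true → G.fst f ≠ a ∧ G.snd f ≠ a) (hcb : G.Conn ω c b) (hca : c ≠ a) :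
    G.WalkAvoiding ω {a} c b := by
  refine ⟨by simpa using hca, ?_⟩
  unfold Conn at hcb
  refine reflTransGen_of_imp (fun x y hxy => ⟨hxy, ?_⟩) hcb
  obtain ⟨f, hf, hend⟩ := hxy
  have := hiso f hf
  simp only [Set.mem_singleton_iff]
  rcases hend with ⟨_, rfl⟩ | ⟨rfl, _⟩
  · exact this.2
  · exact this.1

/-- Walks avoiding a set are monotone in the configuration. -/
theorem WalkAvoiding.mono {ω ω' : Config E} (hle : ω ≤ ω') {W : Set V} {u v : V}
    (h : G.WalkAvoiding ω W u v) : G.WalkAvoiding ω' W u v :=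
  ⟨h.1, reflTransGen_of_imp (fun _ _ hxy => ⟨hxy.1.mono hle, hxy.2⟩) h.2⟩

/-- **Avoiding a pendant vertex**: if every edge at `a` is `e`, `c ~ b` in `S`, and `c, b ≠ a`, then
`c` reaches `b` by a red walk avoiding `{a}`: close `e` — by the contraction lemma the connection
survives (the alternatives would join `c` or `b` to the then isolated `a`), and a walk in `S − e`
never visits `a`. -/
theorem walkAvoiding_of_leaf {S : Config E} {a b c : V} {e : E} [DecidableEq E]
    (hleaf : ∀ f, G.fst f = a ∨ G.snd f = a → f = e) (hcb : G.Conn S c b) (hca : c ≠ a)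
    (hba : b ≠ a) : G.WalkAvoiding S {a} c b := by
  by_cases hea : G.fst e = a ∨ G.snd e = a
  · -- `e` is the edge at `a`: close it
    set ω := Function.update S e false with hω
    have hiso : ∀ f, ω f = true → G.fst f ≠ a ∧ G.snd f ≠ a := by
      intro f hf
      by_contra h
      have hfe : f = e := hleaf f (by
        by_cases h1 : G.fst f = a
        · exact Or.inl h1
        · exact Or.inr (by
            by_contra h2
            exact h ⟨h1, h2⟩))
      subst hfe
      simp [hω] at hf
    have hcb' : G.Conn ω c b := by
      by_cases he : S e = true
      · have hS : S = Function.update ω e true := by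
          rw [hω, Function.update_idem, ← he, Function.update_eq_self]
        rw [hS] at hcb
        rcases (conn_update_true_iff ω e c b).1 hcb with h | ⟨h1, h2⟩ | ⟨h1, h2⟩
        · exact h
        · exfalso
          rcases hea with h3 | h3
          · rw [h3] at h1
            exact hca (eq_of_conn_of_isolated hiso h1.symm)
          · rw [h3] at h2
            exact hba (eq_of_conn_of_isolated hiso h2)
        · exfalso
          rcases hea with h3 | h3
          · rw [h3] at h2
            exact hba (eq_of_conn_of_isolated hiso h2)
          · rw [h3] at h1
            exact hca (eq_of_conn_of_isolated hiso h1.symm)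
      · have hS : S = ω := by
          rw [hω]
          funext f
          by_cases hf : f = e
          · subst hf
            simp only [Function.update_self]
            exact Bool.eq_false_iff.2 he
          · simp [Function.update_of_ne hf]
        rw [hS] at hcb
        exact hcb
    exact (walkAvoiding_singleton_of_isolated hiso hcb' hca).mono (update_false_le S e)
  · -- no edge at `a` at all: every walk avoids `a`
    have hiso : ∀ f, S f = true → G.fst f ≠ a ∧ G.snd f ≠ a := by
      intro f _
      by_contra h
      have hfe : f = e := hleaf f (by
        by_cases h1 : G.fst f = a
        · exact Or.inl h1
        · exact Or.inr (by
            by_contra h2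
            exact h ⟨h1, h2⟩))
      subst hfe
      exact hea (by
        by_cases h1 : G.fst f = a
        · exact Or.inl h1
        · exact Or.inr (by
            by_contra h2
            exact h ⟨h1, h2⟩))
    exact walkAvoiding_singleton_of_isolated hiso hcb hca

/-- **Every `(D,A)` source is `Good_a` when `a` is pendant**: the distinctness `a ≠ c`, `a ≠ b` follows
from the blue separation, the red edge at `a` from `c ~ a`. -/
theorem good_of_leaf {S : Config E} {a b c : V} {e : E} [DecidableEq E]
    (hleaf : ∀ f, G.fst f = a ∨ G.snd f = a → f = e) (hca : G.Conn S c a) (hcb : G.Conn S c b)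
    (hca' : ¬ G.Conn Sᶜ c a) (hab' : ¬ G.Conn Sᶜ a b) :
    G.WalkAvoiding S (G.cluster Sᶜ a) c b := by
  have hne1 : c ≠ a := fun h => hca' (h ▸ Conn.refl G Sᶜ c)
  have hne2 : b ≠ a := fun h => hab' (h ▸ Conn.refl G Sᶜ a)
  -- the edge `e` is red: otherwise `a` is red-isolated, against `c ~ a`
  have he : S e = true := by
    by_contra h
    have hiso : ∀ f, S f = true → G.fst f ≠ a ∧ G.snd f ≠ a := by
      intro f hf
      by_contra h'
      have hfe : f = e := hleaf f (by
        by_cases h1 : G.fst f = a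
        · exact Or.inl h1
        · exact Or.inr (by
            by_contra h2
            exact h' ⟨h1, h2⟩))
      subst hfe
      exact h hf
    exact hne1 (eq_of_conn_of_isolated hiso hca.symm)
  rw [cluster_compl_eq_singleton_of_leaf hleaf he]
  exact walkAvoiding_of_leaf hleaf hcb hne1 hne2

section Count

variable [Fintype V] [DecidableEq V] [Fintype E] [DecidableEq E]

omit [Fintype V] [DecidableEq V] in
open Classical in
/-- **`n(D,A) ≤ #B₂` when `a` is pendant**: every source is `Good_a`, and `Φ_a` injects `Good_a` into
the red type `B₂`. -/
theorem card_DA_le_of_leaf (a b c : V) (e : E)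
    (hleaf : ∀ f, G.fst f = a ∨ G.snd f = a → f = e) :
    (univ.filter fun S : Config E => (G.Conn S c a ∧ G.Conn S c b) ∧
        (¬ G.Conn Sᶜ c a ∧ ¬ G.Conn Sᶜ c b ∧ ¬ G.Conn Sᶜ a b)).card ≤
      (univ.filter fun T : Config E => G.Conn T c b ∧ ¬ G.Conn T c a).card := by
  refine le_trans (Finset.card_le_card ?_) (card_goodA_le (G := G) a b c)
  intro S hS
  simp only [mem_filter, mem_univ, true_and] at hS ⊢
  exact ⟨hS, good_of_leaf hleaf hS.1.1 hS.1.2 hS.2.1 hS.2.2.2⟩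

open Classical in
/-- **`(E00)` on a pendant live vertex `a`**. -/
theorem pFun_liveCells_nonneg_of_leaf (a b c : V) (e : E)
    (hleaf : ∀ f, G.fst f = a ∨ G.snd f = a → f = e) :
    0 ≤ G.pFun c (liveCells a b) (liveCells a b) univ := by
  apply pFun_liveCells_nonneg_of_two_mul
  have h := card_DA_le_of_leaf (G := G) a b c e hleaf
  have h2 := card_B_eq_add (G := G) a b c
  omega

open Classical in
/-- **`(E00)` on a pendant live vertex `b`**. -/
theorem pFun_liveCells_nonneg_of_leaf' (a b c : V) (e : E)
    (hleaf : ∀ f, G.fst f = b ∨ G.snd f = b → f = e) :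
    0 ≤ G.pFun c (liveCells a b) (liveCells a b) univ := by
  apply pFun_liveCells_nonneg_of_two_mul
  -- every source is `Good_b`, and `Φ_b` injects `Good_b` into `B₁`
  have h : (univ.filter fun S : Config E => (G.Conn S c a ∧ G.Conn S c b) ∧
        (¬ G.Conn Sᶜ c a ∧ ¬ G.Conn Sᶜ c b ∧ ¬ G.Conn Sᶜ a b)).card ≤
      (univ.filter fun T : Config E => G.Conn T c a ∧ ¬ G.Conn T c b).card := by
    refine le_trans (Finset.card_le_card ?_) (card_goodB_le (G := G) a b c)
    intro S hS
    simp only [mem_filter, mem_univ, true_and] at hS ⊢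
    refine ⟨hS, good_of_leaf hleaf hS.1.2 hS.1.1 hS.2.2.1 ?_⟩
    exact fun h => hS.2.2.2 h.symm
  have h2 := card_B_eq_add (G := G) a b c
  omega

/-- **THEOREM L2 (bare probe) on a pendant live vertex `a`**. -/
theorem pFun_twoCells_nonneg_of_leaf (a b c : V) (e : E)
    (hleaf : ∀ f, G.fst f = a ∨ G.snd f = a → f = e) {x₁ K₁ x₂ K₂ : ℝ}
    (hx₁ : 0 ≤ x₁ ∧ x₁ ≤ 1) (hx₂ : 0 ≤ x₂ ∧ x₂ ≤ 1) (hK₁ : kMin x₁ ≤ K₁) (hK₂ : kMin x₂ ≤ K₂) :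
    0 ≤ G.pFun c (twoCells a b x₁ x₂) (twoCells a b K₁ K₂) univ :=
  pFun_twoCells_nonneg_of_corner a b c hx₁ hx₂ hK₁ hK₂ (pFun_liveCells_nonneg_of_leaf a b c e hleaf)

/-- **THEOREM L2 (bare probe) on a pendant live vertex `b`**. -/
theorem pFun_twoCells_nonneg_of_leaf' (a b c : V) (e : E)
    (hleaf : ∀ f, G.fst f = b ∨ G.snd f = b → f = e) {x₁ K₁ x₂ K₂ : ℝ}
    (hx₁ : 0 ≤ x₁ ∧ x₁ ≤ 1) (hx₂ : 0 ≤ x₂ ∧ x₂ ≤ 1) (hK₁ : kMin x₁ ≤ K₁) (hK₂ : kMin x₂ ≤ K₂) :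
    0 ≤ G.pFun c (twoCells a b x₁ x₂) (twoCells a b K₁ K₂) univ :=
  pFun_twoCells_nonneg_of_corner a b c hx₁ hx₂ hK₁ hK₂ (pFun_liveCells_nonneg_of_leaf' a b c e hleaf)

/-- **THEOREM L2 (live probe) on a pendant live vertex `a`**: `(P) ≥ 0` at every band state of the
probe and of the two live vertices. -/
theorem pFun_threeCells_nonneg_of_leaf (a b c : V) (e : E)
    (hleaf : ∀ f, G.fst f = a ∨ G.snd f = a → f = e) {z κ x₁ K₁ x₂ K₂ : ℝ}
    (hz : 0 ≤ z ∧ z ≤ 1) (hκ : kMin z ≤ κ) (hx₁ : 0 ≤ x₁ ∧ x₁ ≤ 1) (hx₂ : 0 ≤ x₂ ∧ x₂ ≤ 1)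
    (hK₁ : kMin x₁ ≤ K₁) (hK₂ : kMin x₂ ≤ K₂) :
    0 ≤ G.pFun c (threeCells c a b z x₁ x₂) (threeCells c a b κ K₁ K₂) univ :=
  pFun_threeCells_nonneg_of_E00 c a b hz hκ hx₁ hx₂ hK₁ hK₂
    (pFun_liveCells_nonneg_of_leaf a b c e hleaf)

/-- **THEOREM L2 (live probe) on a pendant live vertex `b`**. -/
theorem pFun_threeCells_nonneg_of_leaf' (a b c : V) (e : E)
    (hleaf : ∀ f, G.fst f = b ∨ G.snd f = b → f = e) {z κ x₁ K₁ x₂ K₂ : ℝ}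
    (hz : 0 ≤ z ∧ z ≤ 1) (hκ : kMin z ≤ κ) (hx₁ : 0 ≤ x₁ ∧ x₁ ≤ 1) (hx₂ : 0 ≤ x₂ ∧ x₂ ≤ 1)
    (hK₁ : kMin x₁ ≤ K₁) (hK₂ : kMin x₂ ≤ K₂) :
    0 ≤ G.pFun c (threeCells c a b z x₁ x₂) (threeCells c a b κ K₁ K₂) univ :=
  pFun_threeCells_nonneg_of_E00 c a b hz hκ hx₁ hx₂ hK₁ hK₂
    (pFun_liveCells_nonneg_of_leaf' a b c e hleaf)

end Count

end MultiGraph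

end PercRepro
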